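import Summits.Parity.GeneralizedHardyLittlewood.Theorems.GreenTaoLevelTwoMNTwoInverseOfPropTwentyTwo
import Summits.Parity.GeneralizedHardyLittlewood.Theorems.GreenTaoLevelTwoMNTwoPropTwentyTwoBudget
import Summits.Parity.GeneralizedHardyLittlewood.Theorems.GreenTaoLevelTwoMNTwoTypeIHalf

/-!
# Route `GreenTaoLevelTwo`, crux `MNTwo` (stmt-Parity-21276), line `birth`, stub `stub_mnVertical`:
# the stub from the two halves of Proposition 22 at the budget scale (GT 2008b §§2, 8–12)

Block H6 of the `stub_mnVertical` census (B. Green, T. Tao, *Quadratic uniformity of the Möbius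
function*, Ann. Inst. Fourier 58 (2008) = arXiv:math/0606087).  Def-free composition of
`…MNTwoPropTwentyTwoBudget.prop22_budget_of_branches` (§10 assembly) with
`…MNTwoInverseOfPropTwentyTwo.stub_mnVertical_of_prop22` (§§11–12, §8, App. A): the registered
signature of `stub_mnVertical` follows from the type I half `hI` (Lemma 23 side, to be discharged
from `…MNTwoTypeIBranch.prop22_of_typeI`) and the type II half `hII` (Lemma 24 side, via
`…MNTwoTypeIIBranch.prop22_of_typeII_core`) of Proposition 22 at the budget scale, for all torus
dimensions `k`.

* `stub_mnVertical_of_branches` — the statement just described;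
* `stub_mnVertical_of_typeII_half` — the same with the type I half discharged
  (`…MNTwoTypeIHalf.typeI_half`): THE STUB FOLLOWS FROM THE TYPE II HALF ALONE.

References: [GreenTao2008QuadraticMobius] arXiv:math/0606087 §2, §§8–12, App. A.
-/

noncomputable section

open Finset Real ArithmeticFunction
open scoped ArithmeticFunction.Moebius FourierTransform ComplexConjugate
open Literature.NumberTheory.Sieve
open Literature.NumberTheory.Sieve.GreenTaoLevelTwo (HX IsCompatMetric IsBoxComparable heisenbergWith
  InHeisClass)

namespace Summit.Parity.GeneralizedHardyLittlewood.GreenTaoLevelTwoMNTwoVerticalOfBranches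

open Summit.Parity.GeneralizedHardyLittlewood.GreenTaoLevelTwoMNTwoInverseOfPropTwentyTwo
  (stub_mnVertical_of_prop22)
open Summit.Parity.GeneralizedHardyLittlewood.GreenTaoLevelTwoMNTwoPropTwentyTwoBudget
  (prop22_budget_of_branches)
open Summit.Parity.GeneralizedHardyLittlewood.GreenTaoLevelTwoMNTwoTypeIHalf (typeI_half)

/-- **`stub_mnVertical` from the two halves of Proposition 22 at the budget scale (all `k`).**
The conclusion is the registered signature of `stub_mnVertical` verbatim; composition of
`prop22_budget_of_branches` with `…MNTwoInverseOfPropTwentyTwo.stub_mnVertical_of_prop22`.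
[cite: GreenTao2008QuadraticMobius, §2, §§8–12, App. A] -/
theorem stub_mnVertical_of_branches
    (hI : ∀ (k : ℕ) (aη cη : ℝ), 0 < aη → 0 < cη → ∃ A₂ : ℝ, ∀ A₀ : ℝ, A₂ ≤ A₀ →
      ∃ N₂ : ℕ, ∀ N : ℕ, N₂ ≤ N → 2 ≤ N →
      ∀ (α : Fin k → ℝ) (n₀ : ℤ) (ρ : ℝ), 0 < ρ → 100000 * ρ < 1 → (Real.log N ^ aη)⁻¹ ≤ ρ →
      ∀ (φ : ℤ → UnitAddCircle),
        (∀ n a b c : ℤ,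
          (⨆ i : Fin k, ‖((((n - n₀ : ℤ) : ℝ) * α i : ℝ) : AddCircle (1 : ℝ))‖) +
              |((n - n₀ : ℤ) : ℝ)| / N < 100 * ρ →
          (⨆ i : Fin k, ‖((((n + a - n₀ : ℤ) : ℝ) * α i : ℝ) : AddCircle (1 : ℝ))‖) +
              |((n + a - n₀ : ℤ) : ℝ)| / N < 100 * ρ →
          (⨆ i : Fin k, ‖((((n + b - n₀ : ℤ) : ℝ) * α i : ℝ) : AddCircle (1 : ℝ))‖) +
              |((n + b - n₀ : ℤ) : ℝ)| / N < 100 * ρ →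
          (⨆ i : Fin k, ‖((((n + c - n₀ : ℤ) : ℝ) * α i : ℝ) : AddCircle (1 : ℝ))‖) +
              |((n + c - n₀ : ℤ) : ℝ)| / N < 100 * ρ →
          (⨆ i : Fin k, ‖((((n + a + b - n₀ : ℤ) : ℝ) * α i : ℝ) : AddCircle (1 : ℝ))‖) +
              |((n + a + b - n₀ : ℤ) : ℝ)| / N < 100 * ρ →
          (⨆ i : Fin k, ‖((((n + a + c - n₀ : ℤ) : ℝ) * α i : ℝ) : AddCircle (1 : ℝ))‖) +
              |((n + a + c - n₀ : ℤ) : ℝ)| / N < 100 * ρ →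
          (⨆ i : Fin k, ‖((((n + b + c - n₀ : ℤ) : ℝ) * α i : ℝ) : AddCircle (1 : ℝ))‖) +
              |((n + b + c - n₀ : ℤ) : ℝ)| / N < 100 * ρ →
          (⨆ i : Fin k, ‖((((n + a + b + c - n₀ : ℤ) : ℝ) * α i : ℝ) : AddCircle (1 : ℝ))‖) +
              |((n + a + b + c - n₀ : ℤ) : ℝ)| / N < 100 * ρ →
          φ (n + a + b + c) - φ (n + a + b) - φ (n + a + c) - φ (n + b + c)
            + φ (n + a) + φ (n + b) + φ (n + c) - φ n = 0) →
      ∀ (ψ : ℤ → ℝ), (∀ n, 0 ≤ ψ n) → (∀ n, ψ n ≤ 1) →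
        (∀ n, ψ n ≠ 0 →
          (⨆ i : Fin k, ‖((((n - n₀ : ℤ) : ℝ) * α i : ℝ) : AddCircle (1 : ℝ))‖) +
            |((n - n₀ : ℤ) : ℝ)| / N < ρ) →
        (∀ n, ψ n ≠ 0 → (N : ℤ) < n ∧ n ≤ 2 * N) →
        (∀ n n' : ℤ, |ψ n - ψ n'| ≤
          (⨆ i : Fin k, ‖((((n - n' : ℤ) : ℝ) * α i : ℝ) : AddCircle (1 : ℝ))‖) +
            |((n - n' : ℤ) : ℝ)| / N) →
      ∀ (η : ℝ), cη * (Real.log N ^ aη)⁻¹ ≤ η → 2 * η ≤ 1 →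
      ∀ (U j : ℕ), U * U ≤ N →
        η ^ 2 * 2 ^ j ≤ #((Icc 1 U).filter fun d => Nat.log 2 d = j ∧
          η * ((2 * N : ℕ) : ℝ) / 2 ^ j ≤
            ‖∑ w ∈ Icc 1 (2 * N / d), ((ψ ((d * w : ℕ) : ℤ) : ℝ) : ℂ) *
              (AddCircle.toCircle (φ ((d * w : ℕ) : ℤ)) : ℂ)‖) →
      ∀ ρ₁ : ℝ, ρ₁ = ((Real.log N ^ A₀) ^ ((k + 2) * (4 + 4 ^ (k + 2))))⁻¹ →
        ∃ (D : ℕ) (𝒟 : Finset ℕ), 1 ≤ D ∧ 𝒟 ⊆ Icc 1 D ∧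
          4 * (32 * 38 ^ k) * (D : ℝ) ≤ (ρ₁ / 16) ^ (k + 1) * N / 2 ∧
          ρ₁ * (D : ℝ) ^ 2 / Real.log N ^ A₀ ≤ (#𝒟 : ℝ) ^ 2 ∧
          ∀ d ∈ 𝒟, ∀ n ∈ (Finset.Ioo (-(N : ℤ)) N).filter fun n : ℤ =>
              (∀ i, ‖(((n : ℝ) * α i : ℝ) : AddCircle (1 : ℝ))‖ + |(n : ℝ)| / N < ρ₁) ∧
                |(n : ℝ)| / N < ρ₁,
            (d : ℤ) ∣ n → ∃ q : ℕ, 1 ≤ q ∧ (q : ℝ) ≤ Real.log N ^ A₀ ∧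
              ‖((q : ℤ)) • (φ (n₀ + n + n) - φ (n₀ + n) - φ (n₀ + n) + φ n₀)‖ ≤
                Real.log N ^ A₀ * ρ₁ ^ 2)
    (hII : ∀ (k : ℕ) (aη cη : ℝ), 0 < aη → 0 < cη → ∃ A₂ : ℝ, ∀ A₀ : ℝ, A₂ ≤ A₀ →
      ∃ N₂ : ℕ, ∀ N : ℕ, N₂ ≤ N → 2 ≤ N →
      ∀ (α : Fin k → ℝ) (n₀ : ℤ) (ρ : ℝ), 0 < ρ → 100000 * ρ < 1 → (Real.log N ^ aη)⁻¹ ≤ ρ →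
      ∀ (φ : ℤ → UnitAddCircle),
        (∀ n a b c : ℤ,
          (⨆ i : Fin k, ‖((((n - n₀ : ℤ) : ℝ) * α i : ℝ) : AddCircle (1 : ℝ))‖) +
              |((n - n₀ : ℤ) : ℝ)| / N < 100 * ρ →
          (⨆ i : Fin k, ‖((((n + a - n₀ : ℤ) : ℝ) * α i : ℝ) : AddCircle (1 : ℝ))‖) +
              |((n + a - n₀ : ℤ) : ℝ)| / N < 100 * ρ →
          (⨆ i : Fin k, ‖((((n + b - n₀ : ℤ) : ℝ) * α i : ℝ) : AddCircle (1 : ℝ))‖) +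
              |((n + b - n₀ : ℤ) : ℝ)| / N < 100 * ρ →
          (⨆ i : Fin k, ‖((((n + c - n₀ : ℤ) : ℝ) * α i : ℝ) : AddCircle (1 : ℝ))‖) +
              |((n + c - n₀ : ℤ) : ℝ)| / N < 100 * ρ →
          (⨆ i : Fin k, ‖((((n + a + b - n₀ : ℤ) : ℝ) * α i : ℝ) : AddCircle (1 : ℝ))‖) +
              |((n + a + b - n₀ : ℤ) : ℝ)| / N < 100 * ρ →
          (⨆ i : Fin k, ‖((((n + a + c - n₀ : ℤ) : ℝ) * α i : ℝ) : AddCircle (1 : ℝ))‖) +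
              |((n + a + c - n₀ : ℤ) : ℝ)| / N < 100 * ρ →
          (⨆ i : Fin k, ‖((((n + b + c - n₀ : ℤ) : ℝ) * α i : ℝ) : AddCircle (1 : ℝ))‖) +
              |((n + b + c - n₀ : ℤ) : ℝ)| / N < 100 * ρ →
          (⨆ i : Fin k, ‖((((n + a + b + c - n₀ : ℤ) : ℝ) * α i : ℝ) : AddCircle (1 : ℝ))‖) +
              |((n + a + b + c - n₀ : ℤ) : ℝ)| / N < 100 * ρ →
          φ (n + a + b + c) - φ (n + a + b) - φ (n + a + c) - φ (n + b + c)
            + φ (n + a) + φ (n + b) + φ (n + c) - φ n = 0) →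
      ∀ (ψ : ℤ → ℝ), (∀ n, 0 ≤ ψ n) → (∀ n, ψ n ≤ 1) →
        (∀ n, ψ n ≠ 0 →
          (⨆ i : Fin k, ‖((((n - n₀ : ℤ) : ℝ) * α i : ℝ) : AddCircle (1 : ℝ))‖) +
            |((n - n₀ : ℤ) : ℝ)| / N < ρ) →
        (∀ n, ψ n ≠ 0 → (N : ℤ) < n ∧ n ≤ 2 * N) →
        (∀ n n' : ℤ, |ψ n - ψ n'| ≤
          (⨆ i : Fin k, ‖((((n - n' : ℤ) : ℝ) * α i : ℝ) : AddCircle (1 : ℝ))‖) +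
            |((n - n' : ℤ) : ℝ)| / N) →
      ∀ (η : ℝ), cη * (Real.log N ^ aη)⁻¹ ≤ η → η ≤ 1 →
      ∀ (u K w' : ℕ), N < (u + 1) ^ 4 → u ≤ K → K * u ≤ 2 * N → w' ∈ Icc 1 (2 * N / K) →
        η * ((2 * N / K : ℕ) : ℝ) - 1 ≤ #((Icc 1 (2 * N / K)).filter fun w => w ≠ w' ∧
          η * K ≤ ‖∑ d ∈ Ioc K (min (2 * K) (min (2 * N / w) (2 * N / w'))),
            ((ψ ((d * w : ℕ) : ℤ) : ℝ) : ℂ) * (AddCircle.toCircle (φ ((d * w : ℕ) : ℤ)) : ℂ) *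
              conj (((ψ ((d * w' : ℕ) : ℤ) : ℝ) : ℂ) *
                (AddCircle.toCircle (φ ((d * w' : ℕ) : ℤ)) : ℂ))‖) →
      ∀ ρ₁ : ℝ, ρ₁ = ((Real.log N ^ A₀) ^ ((k + 2) * (4 + 4 ^ (k + 2))))⁻¹ →
        ∃ (D : ℕ) (𝒟 : Finset ℕ), 1 ≤ D ∧ 𝒟 ⊆ Icc 1 D ∧
          4 * (32 * 38 ^ k) * (D : ℝ) ≤ (ρ₁ / 16) ^ (k + 1) * N / 2 ∧
          ρ₁ * (D : ℝ) ^ 2 / Real.log N ^ A₀ ≤ (#𝒟 : ℝ) ^ 2 ∧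
          ∀ d ∈ 𝒟, ∀ n ∈ (Finset.Ioo (-(N : ℤ)) N).filter fun n : ℤ =>
              (∀ i, ‖(((n : ℝ) * α i : ℝ) : AddCircle (1 : ℝ))‖ + |(n : ℝ)| / N < ρ₁) ∧
                |(n : ℝ)| / N < ρ₁,
            (d : ℤ) ∣ n → ∃ q : ℕ, 1 ≤ q ∧ (q : ℝ) ≤ Real.log N ^ A₀ ∧
              ‖((q : ℤ)) • (φ (n₀ + n + n) - φ (n₀ + n) - φ (n₀ + n) + φ n₀)‖ ≤
                Real.log N ^ A₀ * ρ₁ ^ 2) :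
    (∀ (d : HX → HX → ℝ) (h : IsCompatMetric d), IsBoxComparable d →
      ∀ X : Nilmanifold 2, InHeisClass (heisenbergWith d h) X → ∀ m : ℕ,
        ∀ A : ℝ, 0 < A → ∃ C B : ℝ, ∀ M : ℝ, 1 ≤ M → ∀ N : ℕ, 2 ≤ N →
          ∀ (g : ((X.pow m).prod (Nilmanifold.circle.ofLE one_le_two)).G) (x : ((X.pow m).prod (Nilmanifold.circle.ofLE one_le_two)).G ⧸ ((X.pow m).prod (Nilmanifold.circle.ofLE one_le_two)).Γ) (F₁ F₂ : ((X.pow m).prod (Nilmanifold.circle.ofLE one_le_two)).G ⧸ ((X.pow m).prod (Nilmanifold.circle.ofLE one_le_two)).Γ → ℝ),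
            ((X.pow m).prod (Nilmanifold.circle.ofLE one_le_two)).IsBoundedLipschitz M F₁ → ((X.pow m).prod (Nilmanifold.circle.ofLE one_le_two)).IsBoundedLipschitz M F₂ →
            (∃ θ : ((X.pow m).prod (Nilmanifold.circle.ofLE one_le_two)).G → ℝ, ∀ z : ((X.pow m).prod (Nilmanifold.circle.ofLE one_le_two)).G, z ∈ Subgroup.center ((X.pow m).prod (Nilmanifold.circle.ofLE one_le_two)).G →
              ∀ x : ((X.pow m).prod (Nilmanifold.circle.ofLE one_le_two)).G ⧸ ((X.pow m).prod (Nilmanifold.circle.ofLE one_le_two)).Γ,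
                ((F₁ (z • x) : ℂ) + (F₂ (z • x) : ℂ) * Complex.I) =
                  Complex.exp (2 * Real.pi * Complex.I * θ z) * ((F₁ x : ℂ) + (F₂ x : ℂ) * Complex.I)) →
              ‖∑ n ∈ Finset.Icc 1 N, ((ArithmeticFunction.moebius n : ℝ) : ℂ) *
                  ((F₁ (g ^ n • x) : ℂ) + (F₂ (g ^ n • x) : ℂ) * Complex.I)‖ ≤
                C * M ^ B * N / Real.log N ^ A) :=
  stub_mnVertical_of_prop22 fun k => prop22_budget_of_branches k (hI k) (hII k)


/-- **`stub_mnVertical` from the type II half of Proposition 22 at the budget scale alone.**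
The type I half is `…MNTwoTypeIHalf.typeI_half`; what remains is `hII` (Lemma 24 side, all `k`).
The conclusion is the registered signature of `stub_mnVertical` verbatim.
[cite: GreenTao2008QuadraticMobius, §2, §§8–12, App. A] -/
theorem stub_mnVertical_of_typeII_half
    (hII : ∀ (k : ℕ) (aη cη : ℝ), 0 < aη → 0 < cη → ∃ A₂ : ℝ, ∀ A₀ : ℝ, A₂ ≤ A₀ →
      ∃ N₂ : ℕ, ∀ N : ℕ, N₂ ≤ N → 2 ≤ N →
      ∀ (α : Fin k → ℝ) (n₀ : ℤ) (ρ : ℝ), 0 < ρ → 100000 * ρ < 1 → (Real.log N ^ aη)⁻¹ ≤ ρ →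
      ∀ (φ : ℤ → UnitAddCircle),
        (∀ n a b c : ℤ,
          (⨆ i : Fin k, ‖((((n - n₀ : ℤ) : ℝ) * α i : ℝ) : AddCircle (1 : ℝ))‖) +
              |((n - n₀ : ℤ) : ℝ)| / N < 100 * ρ →
          (⨆ i : Fin k, ‖((((n + a - n₀ : ℤ) : ℝ) * α i : ℝ) : AddCircle (1 : ℝ))‖) +
              |((n + a - n₀ : ℤ) : ℝ)| / N < 100 * ρ →
          (⨆ i : Fin k, ‖((((n + b - n₀ : ℤ) : ℝ) * α i : ℝ) : AddCircle (1 : ℝ))‖) +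
              |((n + b - n₀ : ℤ) : ℝ)| / N < 100 * ρ →
          (⨆ i : Fin k, ‖((((n + c - n₀ : ℤ) : ℝ) * α i : ℝ) : AddCircle (1 : ℝ))‖) +
              |((n + c - n₀ : ℤ) : ℝ)| / N < 100 * ρ →
          (⨆ i : Fin k, ‖((((n + a + b - n₀ : ℤ) : ℝ) * α i : ℝ) : AddCircle (1 : ℝ))‖) +
              |((n + a + b - n₀ : ℤ) : ℝ)| / N < 100 * ρ →
          (⨆ i : Fin k, ‖((((n + a + c - n₀ : ℤ) : ℝ) * α i : ℝ) : AddCircle (1 : ℝ))‖) +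
              |((n + a + c - n₀ : ℤ) : ℝ)| / N < 100 * ρ →
          (⨆ i : Fin k, ‖((((n + b + c - n₀ : ℤ) : ℝ) * α i : ℝ) : AddCircle (1 : ℝ))‖) +
              |((n + b + c - n₀ : ℤ) : ℝ)| / N < 100 * ρ →
          (⨆ i : Fin k, ‖((((n + a + b + c - n₀ : ℤ) : ℝ) * α i : ℝ) : AddCircle (1 : ℝ))‖) +
              |((n + a + b + c - n₀ : ℤ) : ℝ)| / N < 100 * ρ →
          φ (n + a + b + c) - φ (n + a + b) - φ (n + a + c) - φ (n + b + c)
            + φ (n + a) + φ (n + b) + φ (n + c) - φ n = 0) →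
      ∀ (ψ : ℤ → ℝ), (∀ n, 0 ≤ ψ n) → (∀ n, ψ n ≤ 1) →
        (∀ n, ψ n ≠ 0 →
          (⨆ i : Fin k, ‖((((n - n₀ : ℤ) : ℝ) * α i : ℝ) : AddCircle (1 : ℝ))‖) +
            |((n - n₀ : ℤ) : ℝ)| / N < ρ) →
        (∀ n, ψ n ≠ 0 → (N : ℤ) < n ∧ n ≤ 2 * N) →
        (∀ n n' : ℤ, |ψ n - ψ n'| ≤
          (⨆ i : Fin k, ‖((((n - n' : ℤ) : ℝ) * α i : ℝ) : AddCircle (1 : ℝ))‖) +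
            |((n - n' : ℤ) : ℝ)| / N) →
      ∀ (η : ℝ), cη * (Real.log N ^ aη)⁻¹ ≤ η → η ≤ 1 →
      ∀ (u K w' : ℕ), N < (u + 1) ^ 4 → u ≤ K → K * u ≤ 2 * N → w' ∈ Icc 1 (2 * N / K) →
        η * ((2 * N / K : ℕ) : ℝ) - 1 ≤ #((Icc 1 (2 * N / K)).filter fun w => w ≠ w' ∧
          η * K ≤ ‖∑ d ∈ Ioc K (min (2 * K) (min (2 * N / w) (2 * N / w'))),
            ((ψ ((d * w : ℕ) : ℤ) : ℝ) : ℂ) * (AddCircle.toCircle (φ ((d * w : ℕ) : ℤ)) : ℂ) *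
              conj (((ψ ((d * w' : ℕ) : ℤ) : ℝ) : ℂ) *
                (AddCircle.toCircle (φ ((d * w' : ℕ) : ℤ)) : ℂ))‖) →
      ∀ ρ₁ : ℝ, ρ₁ = ((Real.log N ^ A₀) ^ ((k + 2) * (4 + 4 ^ (k + 2))))⁻¹ →
        ∃ (D : ℕ) (𝒟 : Finset ℕ), 1 ≤ D ∧ 𝒟 ⊆ Icc 1 D ∧
          4 * (32 * 38 ^ k) * (D : ℝ) ≤ (ρ₁ / 16) ^ (k + 1) * N / 2 ∧
          ρ₁ * (D : ℝ) ^ 2 / Real.log N ^ A₀ ≤ (#𝒟 : ℝ) ^ 2 ∧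
          ∀ d ∈ 𝒟, ∀ n ∈ (Finset.Ioo (-(N : ℤ)) N).filter fun n : ℤ =>
              (∀ i, ‖(((n : ℝ) * α i : ℝ) : AddCircle (1 : ℝ))‖ + |(n : ℝ)| / N < ρ₁) ∧
                |(n : ℝ)| / N < ρ₁,
            (d : ℤ) ∣ n → ∃ q : ℕ, 1 ≤ q ∧ (q : ℝ) ≤ Real.log N ^ A₀ ∧
              ‖((q : ℤ)) • (φ (n₀ + n + n) - φ (n₀ + n) - φ (n₀ + n) + φ n₀)‖ ≤
                Real.log N ^ A₀ * ρ₁ ^ 2) :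
    (∀ (d : HX → HX → ℝ) (h : IsCompatMetric d), IsBoxComparable d →
      ∀ X : Nilmanifold 2, InHeisClass (heisenbergWith d h) X → ∀ m : ℕ,
        ∀ A : ℝ, 0 < A → ∃ C B : ℝ, ∀ M : ℝ, 1 ≤ M → ∀ N : ℕ, 2 ≤ N →
          ∀ (g : ((X.pow m).prod (Nilmanifold.circle.ofLE one_le_two)).G) (x : ((X.pow m).prod (Nilmanifold.circle.ofLE one_le_two)).G ⧸ ((X.pow m).prod (Nilmanifold.circle.ofLE one_le_two)).Γ) (F₁ F₂ : ((X.pow m).prod (Nilmanifold.circle.ofLE one_le_two)).G ⧸ ((X.pow m).prod (Nilmanifold.circle.ofLE one_le_two)).Γ → ℝ),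
            ((X.pow m).prod (Nilmanifold.circle.ofLE one_le_two)).IsBoundedLipschitz M F₁ → ((X.pow m).prod (Nilmanifold.circle.ofLE one_le_two)).IsBoundedLipschitz M F₂ →
            (∃ θ : ((X.pow m).prod (Nilmanifold.circle.ofLE one_le_two)).G → ℝ, ∀ z : ((X.pow m).prod (Nilmanifold.circle.ofLE one_le_two)).G, z ∈ Subgroup.center ((X.pow m).prod (Nilmanifold.circle.ofLE one_le_two)).G →
              ∀ x : ((X.pow m).prod (Nilmanifold.circle.ofLE one_le_two)).G ⧸ ((X.pow m).prod (Nilmanifold.circle.ofLE one_le_two)).Γ,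
                ((F₁ (z • x) : ℂ) + (F₂ (z • x) : ℂ) * Complex.I) =
                  Complex.exp (2 * Real.pi * Complex.I * θ z) * ((F₁ x : ℂ) + (F₂ x : ℂ) * Complex.I)) →
              ‖∑ n ∈ Finset.Icc 1 N, ((ArithmeticFunction.moebius n : ℝ) : ℂ) *
                  ((F₁ (g ^ n • x) : ℂ) + (F₂ (g ^ n • x) : ℂ) * Complex.I)‖ ≤
                C * M ^ B * N / Real.log N ^ A) :=
  stub_mnVertical_of_branches (fun k => typeI_half k) hII

end Summit.Parity.GeneralizedHardyLittlewood.GreenTaoLevelTwoMNTwoVerticalOfBranches
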